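import Mathlib
import HarnessLib
import Summits.HubbardSuperconductivity.HubbardSuperconductivity.Theorems.KLProgrammeKLRegimeThinPairTangentData

/-!
# K3 VL child `KLRegimeVolumeLimitV17F2` (stmt-HubbardSuperconductivity-20440), located item #23 «W2-HALF-VL», brick «W2H-OVL» part 19 (PIECE, step-free):
# the per-piece weighted `ℓ¹` bound of the thin-pair frame difference WITHOUT the integer-step hypotheses — the step and both tangencies are produced by
# `thinPair_tangent_data` (`T₁ = 4 + 2A`, transported `T₂`), the identically-vanishing pairs are settled by `0 ≤ RHS`

Cell `gate-hubbard-kl`, seat p3 (g15), lead of #23.  Same binder list as `charSumWt_thinPairDiff_le_twoScale` (part 14) except that `(v, hvj, hvlen, hvtan₁, hvtan₂)`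
and `0 ≤ T₁, 0 ≤ T₂` are replaced by `T₁ = 4 + 2A`, a bound `frameDist K K′ ≤ fd` and the transport inequality
`(4+2A) + (2K₂·(ρ_k + ρ_{k+1} + fd/(Dt_min−2A)) + G₁/x)·(N_r + ½) ≤ T₂`; the conclusion is part 14's, for EVERY pair `(ω′, a′)`.

* **`charSumWt_thinPairDiff_le_piece`**.

This is the form the flow regime file instantiates (names by `rfl`, thresholds from parts 17–18).  No definitions, no sorry.  Nothing asserts any stub, K3, VL or
superconductivity. [cite: BenfattoGiulianiMastropietro2006, §2.5 Lemma 2.2, §2.7 (2.69)–(2.71a), §3 (3.2)–(3.8)]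
-/

noncomputable section

namespace Summit.HubbardSuperconductivity.HubbardSuperconductivity.Theorems.TorusFourierL2

set_option linter.dupNamespace false -- summit = problem name (single-conjunct summit), D-0017

open Set Finset Filter Topology Literature.MathematicalPhysics.QuantumLattice Literature.MathematicalPhysics.QuantumLattice.BandSectorCounting
open Literature.MathematicalPhysics.QuantumLattice.FermiRG Literature.Probability.LatticeModels Literature.Analysis.SpecialFunctions Literature.Analysis.Calculus
open Summit.HubbardSuperconductivity.HubbardSuperconductivity.Theorems.DispersionFlow
open Summit.HubbardSuperconductivity.HubbardSuperconductivity.Theorems.KLRegimeSplit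
open Summit.HubbardSuperconductivity.HubbardSuperconductivity.Theorems.KLProgrammeLegKernels
open Summit.HubbardSuperconductivity.HubbardSuperconductivity.Theorems.PerturbedFermiCurve
open scoped Real Nat

section PieceStepFree

open Classical

set_option maxHeartbeats 2000000 -- the accumulated binder list of six instances: every `variable` command re-elaborates all of it

variable {L M : ℕ} [NeZero L] [NeZero M] {a b : ℝ} (B : BandBounds a b) {K K' : TrigPolyC4v} {A A₃ A₃' : ℝ}
  (hA : ∀ p : Momentum, ∀ j ≤ 2, ‖iteratedFDeriv ℝ j (frameShift K) p‖ ≤ A) (hA' : ∀ p : Momentum, ∀ j ≤ 2, ‖iteratedFDeriv ℝ j (frameShift K') p‖ ≤ A)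
  (hA3 : ∀ p : Momentum, ‖iteratedFDeriv ℝ 3 (frameShift K) p‖ ≤ A₃) (hA3' : ∀ p : Momentum, ‖iteratedFDeriv ℝ 3 (frameShift K') p‖ ≤ A₃')
  (hADt : 2 * A < B.Dtmin)
  {μ e₀ z β : ℝ} (he : 0 < e₀) (hz : 0 < z) (hz1 : z ≤ 1) (hgap : e₀ + A + z ^ 2 < -μ) (h3 : e₀ + A - μ ≤ 3)
  (hlo : a ≤ μ - A - e₀) (hhi : μ + A + e₀ ≤ b) (hβ : 0 < β) (hρA : 4 * A < 2 * B.rhomin)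
  (k : ℕ) {K₂ K₂' : ℝ} (hK₂ : ∀ p, ‖iteratedFDeriv ℝ 2 (frameLevel μ K) p‖ ≤ K₂) (hK₂' : ∀ p, ‖iteratedFDeriv ℝ 2 (frameLevel μ K') p‖ ≤ K₂')
  (hMa : klScale e₀ (k + 1) * β < π * (2 * M - 5)) (hMb : klScale e₀ k * β < π * (2 * M - 5))
  {Nr T₁ T₂ : ℝ} (hNr : 2 ≤ Nr) (hLz : 3 * |2 * π / L| * (Nr + 1 / 2) ≤ z) (hT₁ : T₁ = 4 + 2 * A)
  {d : ℝ} (hd : 0 ≤ d) (hd1 : ∀ u, |deriv (bgmCutoffSq e₀) u| ≤ d) (hd2 : ∀ u, |iteratedDeriv 2 (bgmCutoffSq e₀) u| ≤ d)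
  (hd3 : ∀ u, |iteratedDeriv 3 (bgmCutoffSq e₀) u| ≤ d) (hd4 : ∀ u, |iteratedDeriv 4 (bgmCutoffSq e₀) u| ≤ d)
  {Ba : ℝ} (hB0 : 0 ≤ Ba)
  (hB : ∀ (i : ℕ), i ≤ 3 → ∀ (n : ℕ) (ω : ℤ) (θ₀ : ℝ) (q w : Fin 2 → ℝ) (t : ℝ) {r₀ : ℝ}, 0 < r₀ →
    r₀ ≤ ‖momToComplex (q + t • w)‖ → |sectorRelAngle θ₀ (q + t • w)| < π →
    ‖iteratedDeriv i (fun t : ℝ => sectorWeightCirc n ω (polarAngle (q + t • w))) t‖ ≤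
      (3 : ℕ)! * Ba * ((1 + (sectorWidth n)⁻¹ * (3 : ℕ)!) * ‖momToComplex w‖ / r₀) ^ i)
  -- the piece `ν = e_K − e_{K′}` in the two-scale class at depth `x`
  {ν : (Fin 2 → ℝ) → ℝ} (hν : ∀ p, ν p = frameLevel μ K (WithLp.toLp 2 p) - frameLevel μ K' (WithLp.toLp 2 p)) (hνs : ContDiff ℝ 3 ν)
  {x G₀ G₁ G₂ G₃ ε₃₀ ε₃₁ : ℝ} (hx : 1 ≤ x) (hG₀ : 0 < G₀) (hG₁ : 0 ≤ G₁) (hG₂ : 0 ≤ G₂) (hG₃ : 0 ≤ G₃) (hε₃₀ : 0 ≤ ε₃₀) (hε₃₁ : 0 ≤ ε₃₁)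
  (hN₀ : ∀ p, |ν p| ≤ G₀ / x ^ 2) (hN₁ : ∀ p, ‖fderiv ℝ ν p‖ ≤ G₁ / x) (hN₂ : ∀ p, ‖iteratedFDeriv ℝ 2 ν p‖ ≤ G₂)
  (hN₃ : ∀ p, ‖iteratedFDeriv ℝ 3 ν p‖ ≤ G₃ * x) (hGΛ : G₀ / x ^ 2 ≤ klScale e₀ (k + 1))
  (hA₃x : 4 + 8 * A₃ ≤ ε₃₀ + ε₃₁ * x) (hA₃x' : 4 + 8 * A₃' ≤ ε₃₀ + ε₃₁ * x)
  -- the frame distance and the transported tangency constant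
  {fd : ℝ} (hfd : frameDist K K' ≤ fd)
  (hT₂ : (4 + 2 * A) + (2 * K₂ * ((klScale e₀ k + B.smax * B.Dtmin * (3 * sectorWidth k / 4)) / (B.Dtmin - 2 * A) +
      (klScale e₀ (k + 1) + B.smax * B.Dtmin * (3 * sectorWidth (k + 1) / 4)) / (B.Dtmin - 2 * A) + fd / (B.Dtmin - 2 * A)) + G₁ / x) *
      (Nr + 1 / 2) ≤ T₂)
  -- the names: family A (iso, term 1)
  {κA C₁A B₀xA tA ε₂A ζA 𝔮₁A 𝔮₂A 𝔮₃₀A 𝔮₃₁A d₁A w₁A d₂A w₂A d₃₀A d₃₁A w₃₀A w₃₁A o₁₀A o₁₁A o₂₀A o₂₁A o₂₂A o₃₀A o₃₁A o₃₂A o₃₃A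
    R₁₀A R₁₁A R₂₀A R₂₁A R₂₂A R₃₀A R₃₁A R₃₂A R₃₃A r₁₀A r₁₁A r₂₀A r₂₁A r₂₂A r₃₀A r₃₁A r₃₂A r₃₃A : ℝ}
  (hκA : κA = e₀ ^ 2 / klScale e₀ (k + 1) ^ 2) (hC₁A : C₁A = d * e₀ ^ 2 / klScale e₀ (k + 1) ^ 2)
  (hB₀xA : B₀xA = C₁A * (G₀ / x ^ 2 * (2 * (klScale e₀ (k + 1) + G₀ / x ^ 2) + G₀ / x ^ 2)))
  (htA : tA = 4 + 2 * A) (hε₂A : ε₂A = 4 + 4 * A) (hζA : ζA = (1 + 6 * (sectorWidth (k + 1))⁻¹) + (1 + 6 * (sectorWidth k)⁻¹))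
  (h𝔮₁A : 𝔮₁A = 2 * (d * e₀ ^ 2) * tA / klScale e₀ k + 1 * (12 * Ba * ζA))
  (h𝔮₂A : 𝔮₂A = (4 * (d * e₀ ^ 4) + 2 * (d * e₀ ^ 2)) * tA ^ 2 / klScale e₀ k ^ 2 + 2 * (d * e₀ ^ 2) * (4 + 4 * A) / klScale e₀ k +
    4 * (d * e₀ ^ 2) * tA / klScale e₀ k * (1 * (12 * Ba * ζA)) + 1 * ((12 * Ba + 72 * Ba ^ 2) * ζA ^ 2))
  (h𝔮₃₀A : 𝔮₃₀A = (8 * (d * e₀ ^ 6) + 12 * (d * e₀ ^ 4)) * tA ^ 3 / klScale e₀ k ^ 3 + (12 * (d * e₀ ^ 4) + 6 * (d * e₀ ^ 2)) * (tA * (4 + 4 * A)) / klScale e₀ k ^ 2 +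
    2 * (d * e₀ ^ 2) * ε₃₀ / klScale e₀ k +
    3 * (((4 * (d * e₀ ^ 4) + 2 * (d * e₀ ^ 2)) * tA ^ 2 / klScale e₀ k ^ 2 + 2 * (d * e₀ ^ 2) * (4 + 4 * A) / klScale e₀ k) * (1 * (12 * Ba * ζA))) +
    3 * (2 * (d * e₀ ^ 2) * tA / klScale e₀ k * (1 * ((12 * Ba + 72 * Ba ^ 2) * ζA ^ 2))) + 1 * ((12 * Ba + 216 * Ba ^ 2) * ζA ^ 3))
  (h𝔮₃₁A : 𝔮₃₁A = 2 * (d * e₀ ^ 2) * ε₃₁ / klScale e₀ k)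
  (hd₁A : d₁A = 4 * klScale e₀ (k + 1) * tA) (hw₁A : w₁A = 2 * (tA * G₀ + 2 * klScale e₀ (k + 1) * G₁ + G₀ * G₁)) (hd₂A : d₂A = 2 * (tA ^ 2 + 2 * klScale e₀ (k + 1) * ε₂A))
  (hw₂A : w₂A = 2 * (ε₂A * G₀ + 2 * tA * G₁ + 2 * klScale e₀ (k + 1) * G₂ + G₁ ^ 2 + G₀ * G₂))
  (hd₃₀A : d₃₀A = 2 * (3 * tA * ε₂A + 2 * klScale e₀ (k + 1) * ε₃₀)) (hd₃₁A : d₃₁A = 4 * klScale e₀ (k + 1) * ε₃₁)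
  (hw₃₀A : w₃₀A = 2 * (ε₃₀ * G₀ + ε₃₁ * G₀ + 3 * ε₂A * G₁ + 3 * tA * G₂ + 3 * G₁ * G₂ + G₀ * G₃)) (hw₃₁A : w₃₁A = 4 * klScale e₀ (k + 1) * G₃)
  (ho₁₀A : o₁₀A = tA / klScale e₀ (k + 1)) (ho₁₁A : o₁₁A = 2 * G₁ / G₀) (ho₂₀A : o₂₀A = ε₂A / klScale e₀ (k + 1) + G₁ ^ 2 / (klScale e₀ (k + 1) * G₀))
  (ho₂₁A : o₂₁A = 2 * tA * G₁ / (klScale e₀ (k + 1) * G₀)) (ho₂₂A : o₂₂A = 2 * G₂ / G₀)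
  (ho₃₀A : o₃₀A = ε₃₀ / klScale e₀ (k + 1)) (ho₃₁A : o₃₁A = ε₃₁ / klScale e₀ (k + 1) + 3 * ε₂A * G₁ / (klScale e₀ (k + 1) * G₀) + 3 * G₁ * G₂ / (klScale e₀ (k + 1) * G₀))
  (ho₃₂A : o₃₂A = 3 * tA * G₂ / (klScale e₀ (k + 1) * G₀)) (ho₃₃A : o₃₃A = 2 * G₃ / G₀)
  (hR₁₀A : R₁₀A = κA * (d₁A + w₁A) + o₁₀A) (hR₁₁A : R₁₁A = o₁₁A)
  (hR₂₀A : R₂₀A = κA ^ 2 * (d₁A + w₁A) ^ 2 + κA * (o₁₀A * (2 * d₁A + w₁A)) + κA * (d₂A + w₂A) + o₂₀A) (hR₂₁A : R₂₁A = κA * (o₁₁A * (2 * d₁A + w₁A)) + o₂₁A)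
  (hR₂₂A : R₂₂A = o₂₂A)
  (hR₃₀A : R₃₀A = κA ^ 3 * (d₁A + w₁A) ^ 3 + κA ^ 2 * (o₁₀A * (3 * d₁A ^ 2 + 3 * d₁A * w₁A + w₁A ^ 2)) +
    3 * (κA ^ 2 * ((d₁A + w₁A) * (d₂A + w₂A)) + κA * (d₁A * o₂₀A + o₁₀A * d₂A + o₁₀A * w₂A)) + κA * (d₃₀A + w₃₀A) + o₃₀A)
  (hR₃₁A : R₃₁A = κA ^ 2 * (o₁₁A * (3 * d₁A ^ 2 + 3 * d₁A * w₁A + w₁A ^ 2)) + 3 * (κA * (d₁A * o₂₁A + o₁₁A * d₂A + o₁₁A * w₂A)) + κA * (d₃₁A + w₃₁A) + o₃₁A)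
  (hR₃₂A : R₃₂A = 3 * (κA * (d₁A * o₂₂A)) + o₃₂A) (hR₃₃A : R₃₃A = o₃₃A)
  (hr₁₀A : r₁₀A = R₁₀A + 𝔮₁A) (hr₁₁A : r₁₁A = R₁₁A) (hr₂₀A : r₂₀A = R₂₀A + 2 * R₁₀A * 𝔮₁A + 𝔮₂A) (hr₂₁A : r₂₁A = R₂₁A + 2 * R₁₁A * 𝔮₁A) (hr₂₂A : r₂₂A = R₂₂A)
  (hr₃₀A : r₃₀A = R₃₀A + 3 * R₂₀A * 𝔮₁A + 3 * R₁₀A * 𝔮₂A + 𝔮₃₀A) (hr₃₁A : r₃₁A = R₃₁A + 3 * R₂₁A * 𝔮₁A + 3 * R₁₁A * 𝔮₂A + 𝔮₃₁A)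
  (hr₃₂A : r₃₂A = R₃₂A + 3 * R₂₂A * 𝔮₁A) (hr₃₃A : r₃₃A = R₃₃A)

  -- family B (tangent, term 1)
  {ρfB tB ε₂B ζB 𝔮₁B 𝔮₂B 𝔮₃₀B 𝔮₃₁B d₁B w₁B d₂B w₂B d₃₀B d₃₁B w₃₀B w₃₁B o₁₀B o₁₁B o₂₀B o₂₁B o₂₂B o₃₀B o₃₁B o₃₂B o₃₃B
    R₁₀B R₁₁B R₂₀B R₂₁B R₂₂B R₃₀B R₃₁B R₃₂B R₃₃B r₁₀B r₁₁B r₂₀B r₂₁B r₂₂B r₃₀B r₃₁B r₃₂B r₃₃B : ℝ}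
  (hρfB : ρfB = (klScale e₀ k + B.smax * B.Dtmin * (3 * sectorWidth k / 4)) / (B.Dtmin - 2 * A))
  (htB : tB = T₁ / (Nr - 1) + K₂ * (Real.sqrt 2 * ρfB)) (hε₂B : ε₂B = 4 + 4 * A) (hζB : ζB = (1 + 6 * (sectorWidth (k + 1))⁻¹) + (1 + 6 * (sectorWidth k)⁻¹))
  (h𝔮₁B : 𝔮₁B = 2 * (d * e₀ ^ 2) * tB / klScale e₀ k + 1 * (12 * Ba * ζB))
  (h𝔮₂B : 𝔮₂B = (4 * (d * e₀ ^ 4) + 2 * (d * e₀ ^ 2)) * tB ^ 2 / klScale e₀ k ^ 2 + 2 * (d * e₀ ^ 2) * (4 + 4 * A) / klScale e₀ k +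
    4 * (d * e₀ ^ 2) * tB / klScale e₀ k * (1 * (12 * Ba * ζB)) + 1 * ((12 * Ba + 72 * Ba ^ 2) * ζB ^ 2))
  (h𝔮₃₀B : 𝔮₃₀B = (8 * (d * e₀ ^ 6) + 12 * (d * e₀ ^ 4)) * tB ^ 3 / klScale e₀ k ^ 3 + (12 * (d * e₀ ^ 4) + 6 * (d * e₀ ^ 2)) * (tB * (4 + 4 * A)) / klScale e₀ k ^ 2 +
    2 * (d * e₀ ^ 2) * ε₃₀ / klScale e₀ k +
    3 * (((4 * (d * e₀ ^ 4) + 2 * (d * e₀ ^ 2)) * tB ^ 2 / klScale e₀ k ^ 2 + 2 * (d * e₀ ^ 2) * (4 + 4 * A) / klScale e₀ k) * (1 * (12 * Ba * ζB))) +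
    3 * (2 * (d * e₀ ^ 2) * tB / klScale e₀ k * (1 * ((12 * Ba + 72 * Ba ^ 2) * ζB ^ 2))) + 1 * ((12 * Ba + 216 * Ba ^ 2) * ζB ^ 3))
  (h𝔮₃₁B : 𝔮₃₁B = 2 * (d * e₀ ^ 2) * ε₃₁ / klScale e₀ k)
  (hd₁B : d₁B = 4 * klScale e₀ (k + 1) * tB) (hw₁B : w₁B = 2 * (tB * G₀ + 2 * klScale e₀ (k + 1) * G₁ + G₀ * G₁)) (hd₂B : d₂B = 2 * (tB ^ 2 + 2 * klScale e₀ (k + 1) * ε₂B))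
  (hw₂B : w₂B = 2 * (ε₂B * G₀ + 2 * tB * G₁ + 2 * klScale e₀ (k + 1) * G₂ + G₁ ^ 2 + G₀ * G₂))
  (hd₃₀B : d₃₀B = 2 * (3 * tB * ε₂B + 2 * klScale e₀ (k + 1) * ε₃₀)) (hd₃₁B : d₃₁B = 4 * klScale e₀ (k + 1) * ε₃₁)
  (hw₃₀B : w₃₀B = 2 * (ε₃₀ * G₀ + ε₃₁ * G₀ + 3 * ε₂B * G₁ + 3 * tB * G₂ + 3 * G₁ * G₂ + G₀ * G₃)) (hw₃₁B : w₃₁B = 4 * klScale e₀ (k + 1) * G₃)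
  (ho₁₀B : o₁₀B = tB / klScale e₀ (k + 1)) (ho₁₁B : o₁₁B = 2 * G₁ / G₀) (ho₂₀B : o₂₀B = ε₂B / klScale e₀ (k + 1) + G₁ ^ 2 / (klScale e₀ (k + 1) * G₀))
  (ho₂₁B : o₂₁B = 2 * tB * G₁ / (klScale e₀ (k + 1) * G₀)) (ho₂₂B : o₂₂B = 2 * G₂ / G₀)
  (ho₃₀B : o₃₀B = ε₃₀ / klScale e₀ (k + 1)) (ho₃₁B : o₃₁B = ε₃₁ / klScale e₀ (k + 1) + 3 * ε₂B * G₁ / (klScale e₀ (k + 1) * G₀) + 3 * G₁ * G₂ / (klScale e₀ (k + 1) * G₀))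
  (ho₃₂B : o₃₂B = 3 * tB * G₂ / (klScale e₀ (k + 1) * G₀)) (ho₃₃B : o₃₃B = 2 * G₃ / G₀)
  (hR₁₀B : R₁₀B = κA * (d₁B + w₁B) + o₁₀B) (hR₁₁B : R₁₁B = o₁₁B)
  (hR₂₀B : R₂₀B = κA ^ 2 * (d₁B + w₁B) ^ 2 + κA * (o₁₀B * (2 * d₁B + w₁B)) + κA * (d₂B + w₂B) + o₂₀B) (hR₂₁B : R₂₁B = κA * (o₁₁B * (2 * d₁B + w₁B)) + o₂₁B)
  (hR₂₂B : R₂₂B = o₂₂B)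
  (hR₃₀B : R₃₀B = κA ^ 3 * (d₁B + w₁B) ^ 3 + κA ^ 2 * (o₁₀B * (3 * d₁B ^ 2 + 3 * d₁B * w₁B + w₁B ^ 2)) +
    3 * (κA ^ 2 * ((d₁B + w₁B) * (d₂B + w₂B)) + κA * (d₁B * o₂₀B + o₁₀B * d₂B + o₁₀B * w₂B)) + κA * (d₃₀B + w₃₀B) + o₃₀B)
  (hR₃₁B : R₃₁B = κA ^ 2 * (o₁₁B * (3 * d₁B ^ 2 + 3 * d₁B * w₁B + w₁B ^ 2)) + 3 * (κA * (d₁B * o₂₁B + o₁₁B * d₂B + o₁₁B * w₂B)) + κA * (d₃₁B + w₃₁B) + o₃₁B)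
  (hR₃₂B : R₃₂B = 3 * (κA * (d₁B * o₂₂B)) + o₃₂B) (hR₃₃B : R₃₃B = o₃₃B)
  (hr₁₀B : r₁₀B = R₁₀B + 𝔮₁B) (hr₁₁B : r₁₁B = R₁₁B) (hr₂₀B : r₂₀B = R₂₀B + 2 * R₁₀B * 𝔮₁B + 𝔮₂B) (hr₂₁B : r₂₁B = R₂₁B + 2 * R₁₁B * 𝔮₁B) (hr₂₂B : r₂₂B = R₂₂B)
  (hr₃₀B : r₃₀B = R₃₀B + 3 * R₂₀B * 𝔮₁B + 3 * R₁₀B * 𝔮₂B + 𝔮₃₀B) (hr₃₁B : r₃₁B = R₃₁B + 3 * R₂₁B * 𝔮₁B + 3 * R₁₁B * 𝔮₂B + 𝔮₃₁B)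
  (hr₃₂B : r₃₂B = R₃₂B + 3 * R₂₂B * 𝔮₁B) (hr₃₃B : r₃₃B = R₃₃B)

  -- family C (iso, term 2)
  {κC C₁C B₀xC tC ε₂C ζC 𝔮₁C 𝔮₂C 𝔮₃₀C 𝔮₃₁C d₁C w₁C d₂C w₂C d₃₀C d₃₁C w₃₀C w₃₁C o₁₀C o₁₁C o₂₀C o₂₁C o₂₂C o₃₀C o₃₁C o₃₂C o₃₃C
    R₁₀C R₁₁C R₂₀C R₂₁C R₂₂C R₃₀C R₃₁C R₃₂C R₃₃C r₁₀C r₁₁C r₂₀C r₂₁C r₂₂C r₃₀C r₃₁C r₃₂C r₃₃C : ℝ}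
  (hκC : κC = e₀ ^ 2 / klScale e₀ k ^ 2) (hC₁C : C₁C = d * e₀ ^ 2 / klScale e₀ k ^ 2)
  (hB₀xC : B₀xC = C₁C * (G₀ / x ^ 2 * (2 * (klScale e₀ k + G₀ / x ^ 2) + G₀ / x ^ 2)))
  (htC : tC = 4 + 2 * A) (hε₂C : ε₂C = 4 + 4 * A) (hζC : ζC = (1 + 6 * (sectorWidth k)⁻¹) + (1 + 6 * (sectorWidth (k + 1))⁻¹))
  (h𝔮₁C : 𝔮₁C = 2 * (d * e₀ ^ 2) * tC / klScale e₀ (k + 1) + 1 * (12 * Ba * ζC))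
  (h𝔮₂C : 𝔮₂C = (4 * (d * e₀ ^ 4) + 2 * (d * e₀ ^ 2)) * tC ^ 2 / klScale e₀ (k + 1) ^ 2 + 2 * (d * e₀ ^ 2) * (4 + 4 * A) / klScale e₀ (k + 1) +
    4 * (d * e₀ ^ 2) * tC / klScale e₀ (k + 1) * (1 * (12 * Ba * ζC)) + 1 * ((12 * Ba + 72 * Ba ^ 2) * ζC ^ 2))
  (h𝔮₃₀C : 𝔮₃₀C = (8 * (d * e₀ ^ 6) + 12 * (d * e₀ ^ 4)) * tC ^ 3 / klScale e₀ (k + 1) ^ 3 + (12 * (d * e₀ ^ 4) + 6 * (d * e₀ ^ 2)) * (tC * (4 + 4 * A)) / klScale e₀ (k + 1) ^ 2 +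
    2 * (d * e₀ ^ 2) * ε₃₀ / klScale e₀ (k + 1) +
    3 * (((4 * (d * e₀ ^ 4) + 2 * (d * e₀ ^ 2)) * tC ^ 2 / klScale e₀ (k + 1) ^ 2 + 2 * (d * e₀ ^ 2) * (4 + 4 * A) / klScale e₀ (k + 1)) * (1 * (12 * Ba * ζC))) +
    3 * (2 * (d * e₀ ^ 2) * tC / klScale e₀ (k + 1) * (1 * ((12 * Ba + 72 * Ba ^ 2) * ζC ^ 2))) + 1 * ((12 * Ba + 216 * Ba ^ 2) * ζC ^ 3))
  (h𝔮₃₁C : 𝔮₃₁C = 2 * (d * e₀ ^ 2) * ε₃₁ / klScale e₀ (k + 1))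
  (hd₁C : d₁C = 4 * klScale e₀ k * tC) (hw₁C : w₁C = 2 * (tC * G₀ + 2 * klScale e₀ k * G₁ + G₀ * G₁)) (hd₂C : d₂C = 2 * (tC ^ 2 + 2 * klScale e₀ k * ε₂C))
  (hw₂C : w₂C = 2 * (ε₂C * G₀ + 2 * tC * G₁ + 2 * klScale e₀ k * G₂ + G₁ ^ 2 + G₀ * G₂))
  (hd₃₀C : d₃₀C = 2 * (3 * tC * ε₂C + 2 * klScale e₀ k * ε₃₀)) (hd₃₁C : d₃₁C = 4 * klScale e₀ k * ε₃₁)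
  (hw₃₀C : w₃₀C = 2 * (ε₃₀ * G₀ + ε₃₁ * G₀ + 3 * ε₂C * G₁ + 3 * tC * G₂ + 3 * G₁ * G₂ + G₀ * G₃)) (hw₃₁C : w₃₁C = 4 * klScale e₀ k * G₃)
  (ho₁₀C : o₁₀C = tC / klScale e₀ k) (ho₁₁C : o₁₁C = 2 * G₁ / G₀) (ho₂₀C : o₂₀C = ε₂C / klScale e₀ k + G₁ ^ 2 / (klScale e₀ k * G₀))
  (ho₂₁C : o₂₁C = 2 * tC * G₁ / (klScale e₀ k * G₀)) (ho₂₂C : o₂₂C = 2 * G₂ / G₀)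
  (ho₃₀C : o₃₀C = ε₃₀ / klScale e₀ k) (ho₃₁C : o₃₁C = ε₃₁ / klScale e₀ k + 3 * ε₂C * G₁ / (klScale e₀ k * G₀) + 3 * G₁ * G₂ / (klScale e₀ k * G₀))
  (ho₃₂C : o₃₂C = 3 * tC * G₂ / (klScale e₀ k * G₀)) (ho₃₃C : o₃₃C = 2 * G₃ / G₀)
  (hR₁₀C : R₁₀C = κC * (d₁C + w₁C) + o₁₀C) (hR₁₁C : R₁₁C = o₁₁C)
  (hR₂₀C : R₂₀C = κC ^ 2 * (d₁C + w₁C) ^ 2 + κC * (o₁₀C * (2 * d₁C + w₁C)) + κC * (d₂C + w₂C) + o₂₀C) (hR₂₁C : R₂₁C = κC * (o₁₁C * (2 * d₁C + w₁C)) + o₂₁C)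
  (hR₂₂C : R₂₂C = o₂₂C)
  (hR₃₀C : R₃₀C = κC ^ 3 * (d₁C + w₁C) ^ 3 + κC ^ 2 * (o₁₀C * (3 * d₁C ^ 2 + 3 * d₁C * w₁C + w₁C ^ 2)) +
    3 * (κC ^ 2 * ((d₁C + w₁C) * (d₂C + w₂C)) + κC * (d₁C * o₂₀C + o₁₀C * d₂C + o₁₀C * w₂C)) + κC * (d₃₀C + w₃₀C) + o₃₀C)
  (hR₃₁C : R₃₁C = κC ^ 2 * (o₁₁C * (3 * d₁C ^ 2 + 3 * d₁C * w₁C + w₁C ^ 2)) + 3 * (κC * (d₁C * o₂₁C + o₁₁C * d₂C + o₁₁C * w₂C)) + κC * (d₃₁C + w₃₁C) + o₃₁C)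
  (hR₃₂C : R₃₂C = 3 * (κC * (d₁C * o₂₂C)) + o₃₂C) (hR₃₃C : R₃₃C = o₃₃C)
  (hr₁₀C : r₁₀C = R₁₀C + 𝔮₁C) (hr₁₁C : r₁₁C = R₁₁C) (hr₂₀C : r₂₀C = R₂₀C + 2 * R₁₀C * 𝔮₁C + 𝔮₂C) (hr₂₁C : r₂₁C = R₂₁C + 2 * R₁₁C * 𝔮₁C) (hr₂₂C : r₂₂C = R₂₂C)
  (hr₃₀C : r₃₀C = R₃₀C + 3 * R₂₀C * 𝔮₁C + 3 * R₁₀C * 𝔮₂C + 𝔮₃₀C) (hr₃₁C : r₃₁C = R₃₁C + 3 * R₂₁C * 𝔮₁C + 3 * R₁₁C * 𝔮₂C + 𝔮₃₁C)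
  (hr₃₂C : r₃₂C = R₃₂C + 3 * R₂₂C * 𝔮₁C) (hr₃₃C : r₃₃C = R₃₃C)

  -- family D (tangent, term 2)
  {ρfD tD ε₂D ζD 𝔮₁D 𝔮₂D 𝔮₃₀D 𝔮₃₁D d₁D w₁D d₂D w₂D d₃₀D d₃₁D w₃₀D w₃₁D o₁₀D o₁₁D o₂₀D o₂₁D o₂₂D o₃₀D o₃₁D o₃₂D o₃₃D
    R₁₀D R₁₁D R₂₀D R₂₁D R₂₂D R₃₀D R₃₁D R₃₂D R₃₃D r₁₀D r₁₁D r₂₀D r₂₁D r₂₂D r₃₀D r₃₁D r₃₂D r₃₃D : ℝ}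
  (hρfD : ρfD = (klScale e₀ (k + 1) + B.smax * B.Dtmin * (3 * sectorWidth (k + 1) / 4)) / (B.Dtmin - 2 * A))
  (htD : tD = T₂ / (Nr - 1) + K₂' * (Real.sqrt 2 * ρfD)) (hε₂D : ε₂D = 4 + 4 * A) (hζD : ζD = (1 + 6 * (sectorWidth k)⁻¹) + (1 + 6 * (sectorWidth (k + 1))⁻¹))
  (h𝔮₁D : 𝔮₁D = 2 * (d * e₀ ^ 2) * tD / klScale e₀ (k + 1) + 1 * (12 * Ba * ζD))
  (h𝔮₂D : 𝔮₂D = (4 * (d * e₀ ^ 4) + 2 * (d * e₀ ^ 2)) * tD ^ 2 / klScale e₀ (k + 1) ^ 2 + 2 * (d * e₀ ^ 2) * (4 + 4 * A) / klScale e₀ (k + 1) +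
    4 * (d * e₀ ^ 2) * tD / klScale e₀ (k + 1) * (1 * (12 * Ba * ζD)) + 1 * ((12 * Ba + 72 * Ba ^ 2) * ζD ^ 2))
  (h𝔮₃₀D : 𝔮₃₀D = (8 * (d * e₀ ^ 6) + 12 * (d * e₀ ^ 4)) * tD ^ 3 / klScale e₀ (k + 1) ^ 3 + (12 * (d * e₀ ^ 4) + 6 * (d * e₀ ^ 2)) * (tD * (4 + 4 * A)) / klScale e₀ (k + 1) ^ 2 +
    2 * (d * e₀ ^ 2) * ε₃₀ / klScale e₀ (k + 1) +
    3 * (((4 * (d * e₀ ^ 4) + 2 * (d * e₀ ^ 2)) * tD ^ 2 / klScale e₀ (k + 1) ^ 2 + 2 * (d * e₀ ^ 2) * (4 + 4 * A) / klScale e₀ (k + 1)) * (1 * (12 * Ba * ζD))) +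
    3 * (2 * (d * e₀ ^ 2) * tD / klScale e₀ (k + 1) * (1 * ((12 * Ba + 72 * Ba ^ 2) * ζD ^ 2))) + 1 * ((12 * Ba + 216 * Ba ^ 2) * ζD ^ 3))
  (h𝔮₃₁D : 𝔮₃₁D = 2 * (d * e₀ ^ 2) * ε₃₁ / klScale e₀ (k + 1))
  (hd₁D : d₁D = 4 * klScale e₀ k * tD) (hw₁D : w₁D = 2 * (tD * G₀ + 2 * klScale e₀ k * G₁ + G₀ * G₁)) (hd₂D : d₂D = 2 * (tD ^ 2 + 2 * klScale e₀ k * ε₂D))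
  (hw₂D : w₂D = 2 * (ε₂D * G₀ + 2 * tD * G₁ + 2 * klScale e₀ k * G₂ + G₁ ^ 2 + G₀ * G₂))
  (hd₃₀D : d₃₀D = 2 * (3 * tD * ε₂D + 2 * klScale e₀ k * ε₃₀)) (hd₃₁D : d₃₁D = 4 * klScale e₀ k * ε₃₁)
  (hw₃₀D : w₃₀D = 2 * (ε₃₀ * G₀ + ε₃₁ * G₀ + 3 * ε₂D * G₁ + 3 * tD * G₂ + 3 * G₁ * G₂ + G₀ * G₃)) (hw₃₁D : w₃₁D = 4 * klScale e₀ k * G₃)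
  (ho₁₀D : o₁₀D = tD / klScale e₀ k) (ho₁₁D : o₁₁D = 2 * G₁ / G₀) (ho₂₀D : o₂₀D = ε₂D / klScale e₀ k + G₁ ^ 2 / (klScale e₀ k * G₀))
  (ho₂₁D : o₂₁D = 2 * tD * G₁ / (klScale e₀ k * G₀)) (ho₂₂D : o₂₂D = 2 * G₂ / G₀)
  (ho₃₀D : o₃₀D = ε₃₀ / klScale e₀ k) (ho₃₁D : o₃₁D = ε₃₁ / klScale e₀ k + 3 * ε₂D * G₁ / (klScale e₀ k * G₀) + 3 * G₁ * G₂ / (klScale e₀ k * G₀))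
  (ho₃₂D : o₃₂D = 3 * tD * G₂ / (klScale e₀ k * G₀)) (ho₃₃D : o₃₃D = 2 * G₃ / G₀)
  (hR₁₀D : R₁₀D = κC * (d₁D + w₁D) + o₁₀D) (hR₁₁D : R₁₁D = o₁₁D)
  (hR₂₀D : R₂₀D = κC ^ 2 * (d₁D + w₁D) ^ 2 + κC * (o₁₀D * (2 * d₁D + w₁D)) + κC * (d₂D + w₂D) + o₂₀D) (hR₂₁D : R₂₁D = κC * (o₁₁D * (2 * d₁D + w₁D)) + o₂₁D)
  (hR₂₂D : R₂₂D = o₂₂D)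
  (hR₃₀D : R₃₀D = κC ^ 3 * (d₁D + w₁D) ^ 3 + κC ^ 2 * (o₁₀D * (3 * d₁D ^ 2 + 3 * d₁D * w₁D + w₁D ^ 2)) +
    3 * (κC ^ 2 * ((d₁D + w₁D) * (d₂D + w₂D)) + κC * (d₁D * o₂₀D + o₁₀D * d₂D + o₁₀D * w₂D)) + κC * (d₃₀D + w₃₀D) + o₃₀D)
  (hR₃₁D : R₃₁D = κC ^ 2 * (o₁₁D * (3 * d₁D ^ 2 + 3 * d₁D * w₁D + w₁D ^ 2)) + 3 * (κC * (d₁D * o₂₁D + o₁₁D * d₂D + o₁₁D * w₂D)) + κC * (d₃₁D + w₃₁D) + o₃₁D)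
  (hR₃₂D : R₃₂D = 3 * (κC * (d₁D * o₂₂D)) + o₃₂D) (hR₃₃D : R₃₃D = o₃₃D)
  (hr₁₀D : r₁₀D = R₁₀D + 𝔮₁D) (hr₁₁D : r₁₁D = R₁₁D) (hr₂₀D : r₂₀D = R₂₀D + 2 * R₁₀D * 𝔮₁D + 𝔮₂D) (hr₂₁D : r₂₁D = R₂₁D + 2 * R₁₁D * 𝔮₁D) (hr₂₂D : r₂₂D = R₂₂D)
  (hr₃₀D : r₃₀D = R₃₀D + 3 * R₂₀D * 𝔮₁D + 3 * R₁₀D * 𝔮₂D + 𝔮₃₀D) (hr₃₁D : r₃₁D = R₃₁D + 3 * R₂₁D * 𝔮₁D + 3 * R₁₁D * 𝔮₂D + 𝔮₃₁D)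
  (hr₃₂D : r₃₂D = R₃₂D + 3 * R₂₂D * 𝔮₁D) (hr₃₃D : r₃₃D = R₃₃D)

  -- family E (time, term 1)
  {qt₁E qt₂E qt₃E Dt₁E Dt₂E θ₁E θ₂E θ₃E : ℝ}
  (hqt₁E : qt₁E = 2 * (d * e₀ ^ 2) * |2 * π / β| / klScale e₀ k) (hqt₂E : qt₂E = (4 * (d * e₀ ^ 4) + 2 * (d * e₀ ^ 2)) * (2 * π / β) ^ 2 / klScale e₀ k ^ 2)
  (hqt₃E : qt₃E = (8 * (d * e₀ ^ 6) + 12 * (d * e₀ ^ 4)) * |2 * π / β| ^ 3 / klScale e₀ k ^ 3)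
  (hDt₁E : Dt₁E = 2 * klScale e₀ (k + 1) * |2 * π / β|) (hDt₂E : Dt₂E = 2 * (2 * π / β) ^ 2)
  (hθ₁E : θ₁E = κA * Dt₁E + qt₁E) (hθ₂E : θ₂E = κA ^ 2 * Dt₁E ^ 2 + κA * Dt₂E + 2 * (κA * Dt₁E) * qt₁E + qt₂E)
  (hθ₃E : θ₃E = κA ^ 3 * Dt₁E ^ 3 + 3 * (κA ^ 2 * (Dt₁E * Dt₂E)) + 3 * ((κA ^ 2 * Dt₁E ^ 2 + κA * Dt₂E) * qt₁E) + 3 * (κA * Dt₁E * qt₂E) + qt₃E)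

  -- family F (time, term 2)
  {qt₁F qt₂F qt₃F Dt₁F Dt₂F θ₁F θ₂F θ₃F : ℝ}
  (hqt₁F : qt₁F = 2 * (d * e₀ ^ 2) * |2 * π / β| / klScale e₀ (k + 1)) (hqt₂F : qt₂F = (4 * (d * e₀ ^ 4) + 2 * (d * e₀ ^ 2)) * (2 * π / β) ^ 2 / klScale e₀ (k + 1) ^ 2)
  (hqt₃F : qt₃F = (8 * (d * e₀ ^ 6) + 12 * (d * e₀ ^ 4)) * |2 * π / β| ^ 3 / klScale e₀ (k + 1) ^ 3)
  (hDt₁F : Dt₁F = 2 * klScale e₀ k * |2 * π / β|) (hDt₂F : Dt₂F = 2 * (2 * π / β) ^ 2)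
  (hθ₁F : θ₁F = κC * Dt₁F + qt₁F) (hθ₂F : θ₂F = κC ^ 2 * Dt₁F ^ 2 + κC * Dt₂F + 2 * (κC * Dt₁F) * qt₁F + qt₂F)
  (hθ₃F : θ₃F = κC ^ 3 * Dt₁F ^ 3 + 3 * (κC ^ 2 * (Dt₁F * Dt₂F)) + 3 * ((κC ^ 2 * Dt₁F ^ 2 + κC * Dt₂F) * qt₁F) + 3 * (κC * Dt₁F * qt₂F) + qt₃F)


include B hA hA' hA3 hA3' hADt he hz hz1 hgap h3 hlo hhi hβ hρA hK₂ hK₂' hMa hMb hNr hLz hT₁ hd hd1 hd2 hd3 hd4 hB0 hB hν hνs hx hG₀ hG₁ hG₂ hG₃ hε₃₀ hε₃₁ hN₀ hN₁ hN₂ hN₃ hGΛ hA₃x hA₃x' hfd hT₂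
  hκA hC₁A hB₀xA htA hε₂A hζA h𝔮₁A h𝔮₂A h𝔮₃₀A h𝔮₃₁A hd₁A hw₁A hd₂A hw₂A hd₃₀A hd₃₁A hw₃₀A hw₃₁A ho₁₀A ho₁₁A ho₂₀A ho₂₁A ho₂₂A ho₃₀A ho₃₁A ho₃₂A ho₃₃A hR₁₀A hR₁₁A hR₂₀A hR₂₁A hR₂₂A hR₃₀A hR₃₁A hR₃₂A hR₃₃A hr₁₀A hr₁₁A hr₂₀A hr₂₁A hr₂₂A hr₃₀A hr₃₁A hr₃₂A hr₃₃A hρfB htB hε₂B hζB h𝔮₁B h𝔮₂B h𝔮₃₀B h𝔮₃₁B hd₁B hw₁B hd₂B hw₂B hd₃₀B hd₃₁B hw₃₀B hw₃₁B ho₁₀B ho₁₁B ho₂₀B ho₂₁B ho₂₂B ho₃₀B ho₃₁B ho₃₂B ho₃₃B hR₁₀B hR₁₁B hR₂₀B hR₂₁B hR₂₂B hR₃₀B hR₃₁B hR₃₂B hR₃₃B hr₁₀B hr₁₁B hr₂₀B hr₂₁B hr₂₂B hr₃₀B hr₃₁B hr₃₂B hr₃₃B hκC hC₁C hB₀xC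 htC hε₂C hζC h𝔮₁C h𝔮₂C h𝔮₃₀C h𝔮₃₁C hd₁C hw₁C hd₂C hw₂C hd₃₀C hd₃₁C hw₃₀C hw₃₁C ho₁₀C ho₁₁C ho₂₀C ho₂₁C ho₂₂C ho₃₀C ho₃₁C ho₃₂C ho₃₃C hR₁₀C hR₁₁C hR₂₀C hR₂₁C hR₂₂C hR₃₀C hR₃₁C hR₃₂C hR₃₃C hr₁₀C hr₁₁C hr₂₀C hr₂₁C hr₂₂C hr₃₀C hr₃₁C hr₃₂C hr₃₃C hρfD htD hε₂D hζD h𝔮₁D h𝔮₂D h𝔮₃₀D h𝔮₃₁D hd₁D hw₁D hd₂D hw₂D hd₃₀D hd₃₁D hw₃₀D hw₃₁D ho₁₀D ho₁₁D ho₂₀D ho₂₁D ho₂₂D ho₃₀D ho₃₁D ho₃₂D ho₃₃D hR₁₀D hR₁₁D hR₂₀D hR₂₁D hR₂₂D hR₃₀D hR₃₁D hR₃₂D hR₃₃D hr₁₀D hr₁₁D hr₂₀D hr₂₁D hr₂₂D hr₃₀D hr₃₁D hr₃₂D hr₃₃D hqt₁E hqt₂E hqt₃E hDt₁E hDt₂E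 hθ₁E hθ₂E hθ₃E hqt₁F hqt₂F hqt₃F hDt₁F hDt₂F hθ₁F hθ₂F hθ₃F in

set_option maxHeartbeats 4000000 in
/-- **Weighted `ℓ¹` of the thin-pair frame difference across a two-scale piece, per piece, step-free** (see the module docstring).
[cite: BenfattoGiulianiMastropietro2006, §2.5 Lemma 2.2, §2.7 (2.69)–(2.71a), §3 (3.2)–(3.8)] -/
theorem charSumWt_thinPairDiff_le_piece (ω' : Fin (sectorCount (k + 1))) (a' : Fin (sectorCount k))
    {s₀ ρ ρ₃ : ℝ} (hs₀ : 0 < s₀) (hρ : 0 < ρ) (hρ₃ : 0 < ρ₃)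
    (tθ₁ : θ₃E ≤ (4 / (s₀ * (2 * M : ℕ))) ^ 3) (tθ₂ : θ₃F ≤ (4 / (s₀ * (2 * M : ℕ))) ^ 3)
    (t₀ : π ^ 3 * ρ ^ 3 * (r₃₀A + r₃₀C) ≤ 2 * x ^ 3) (t₁ : π ^ 3 * ρ ^ 3 * (r₃₁A + r₃₁C) ≤ 2 * x ^ 2) (t₂ : π ^ 3 * ρ ^ 3 * (r₃₂A + r₃₂C) ≤ 2 * x)
    (t₃ : π ^ 3 * ρ ^ 3 * (r₃₃A + r₃₃C) ≤ 2)
    (tv₀ : π ^ 3 * ρ ^ 3 * (r₃₀B + r₃₀D) ≤ 2 * x ^ 3) (tv₁ : π ^ 3 * ρ ^ 3 * (r₃₁B + r₃₁D) ≤ 2 * x ^ 2) (tv₂ : π ^ 3 * ρ ^ 3 * (r₃₂B + r₃₂D) ≤ 2 * x)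
    (tv₃ : π ^ 3 * ρ ^ 3 * (r₃₃B + r₃₃D) ≤ 2)
    (tw₀ : 3 * π ^ 2 * ρ₃ ^ 2 * (r₂₀B + r₂₀D) ≤ 4 * x ^ 2) (tw₁ : 3 * π ^ 2 * ρ₃ ^ 2 * (r₂₁B + r₂₁D) ≤ 4 * x) (tw₂ : 3 * π ^ 2 * ρ₃ ^ 2 * (r₂₂B + r₂₂D) ≤ 4) :
    ∑ zz : TorusSite 1 (2 * M) × TorusSite 2 L,
        (1 + s₀ * |(((zz.1 0).valMinAbs : ℤ) : ℝ)| + ρ / x * |(((zz.2 0).valMinAbs : ℤ) : ℝ)| + ρ / x * |(((zz.2 1).valMinAbs : ℤ) : ℝ)|) *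
          ‖∑ q : TorusSite 1 (2 * M) × TorusSite 2 L, (torusChar q.1 zz.1 * torusChar q.2 zz.2) •
            (klAnisoFamily L M β μ K' e₀ (k + 1) ω' (⟨(q.1 0).val, ZMod.val_lt (q.1 0)⟩, q.2) *
              klAnisoFamily L M β μ K' e₀ k a' (⟨(q.1 0).val, ZMod.val_lt (q.1 0)⟩, q.2) -
            klAnisoFamily L M β μ K e₀ (k + 1) ω' (⟨(q.1 0).val, ZMod.val_lt (q.1 0)⟩, q.2) *
              klAnisoFamily L M β μ K e₀ k a' (⟨(q.1 0).val, ZMod.val_lt (q.1 0)⟩, q.2))‖ ≤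
      x * Real.sqrt (524288 * (1 / s₀ + 1) * ((1 + 4 * Real.sqrt 2) ^ 2 * ((2 * Real.sqrt 2 / ρ + 2) * (2 * Real.sqrt 2 / ρ₃ + 2)) + (1 / ρ + 1) ^ 2)) *
        Real.sqrt (24 * (2 * M : ℕ) * (L : ℝ) ^ 2 *
          (2 * ((klScale e₀ (k + 1) * β / π + 1) *
            ((Real.sqrt 2 * L * ((klScale e₀ (k + 1) + (4 + 4 * A) *
                ((klScale e₀ (k + 1) + B.smax * B.Dtmin * (3 * sectorWidth k / 4)) / (B.Dtmin - 2 * A)) ^ 2) / (2 * B.rhomin - 4 * A)) / π + 2) *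
              (Real.sqrt 2 * L * (2 * ((klScale e₀ (k + 1) + B.smax * B.Dtmin * (3 * sectorWidth k / 4)) / (B.Dtmin - 2 * A))) / π + 2))))) * (B₀xA + B₀xC) := by
  have hL : (0 : ℝ) < L := Nat.cast_pos.2 (Nat.pos_of_ne_zero (NeZero.ne L))
  have hπ := Real.pi_pos
  have hx0 : 0 < x := lt_of_lt_of_le one_pos hx
  have hA0 : 0 ≤ A := (norm_nonneg _).trans (hA 0 0 (by norm_num))
  have hK20 : 0 ≤ K₂ := (norm_nonneg _).trans (hK₂ 0)
  have hDt : 0 < B.Dtmin - 2 * A := by linarith only [hADt]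
  have hT₁0 : 0 ≤ T₁ := by rw [hT₁]; positivity
  -- the transported tangency constant is nonnegative
  have hρk0 : 0 ≤ (klScale e₀ k + B.smax * B.Dtmin * (3 * sectorWidth k / 4)) / (B.Dtmin - 2 * A) := by
    have h1 : 0 ≤ klScale e₀ k := by rw [klScale]; positivity
    have h2 := sectorWidth_pos k; have h3 := B.smax_pos; have h4 := B.Dtmin_pos
    exact div_nonneg (by positivity) hDt.le
  have hρk1 : 0 ≤ (klScale e₀ (k + 1) + B.smax * B.Dtmin * (3 * sectorWidth (k + 1) / 4)) / (B.Dtmin - 2 * A) := by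
    have h1 : 0 ≤ klScale e₀ (k + 1) := by rw [klScale]; positivity
    have h2 := sectorWidth_pos (k + 1); have h3 := B.smax_pos; have h4 := B.Dtmin_pos
    exact div_nonneg (by positivity) hDt.le
  have hfd0 : 0 ≤ fd := (frameDist_nonneg K K').trans hfd
  have hT₂0 : 0 ≤ T₂ := by
    refine le_trans ?_ hT₂
    have : 0 ≤ fd / (B.Dtmin - 2 * A) := div_nonneg hfd0 hDt.le
    have : 0 ≤ Nr + 1 / 2 := by linarith only [hNr]
    positivity
  -- the tangent data
  have hT₂' := hT₂
  obtain ⟨v, hvj, hvlen, hvtan₁, hor⟩ := thinPair_tangent_data (L := L) (M := M) B hA hA' hADt he hlo hhi hρA β k hK₂ hNr hν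
    (hνs.differentiable (by norm_num)) hN₁ hfd hT₂' ω' a'
  have hvtan₁' : |fderiv ℝ (fun p : Fin 2 → ℝ => frameLevel μ K (WithLp.toLp 2 p)) (klFermiPoint μ K (sectorCenter k (a' : ℕ)))
      (fun j => 2 * π / L * (v j : ℝ))| ≤ |2 * π / L| * T₁ := by rw [hT₁]; exact hvtan₁
  rcases hor with hzero | hvtan₂
  · -- the difference vanishes identically: the left-hand side is `0`
    have hlhs : ∀ zz : TorusSite 1 (2 * M) × TorusSite 2 L,
        ‖∑ q : TorusSite 1 (2 * M) × TorusSite 2 L, (torusChar q.1 zz.1 * torusChar q.2 zz.2) •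
            (klAnisoFamily L M β μ K' e₀ (k + 1) ω' (⟨(q.1 0).val, ZMod.val_lt (q.1 0)⟩, q.2) *
              klAnisoFamily L M β μ K' e₀ k a' (⟨(q.1 0).val, ZMod.val_lt (q.1 0)⟩, q.2) -
            klAnisoFamily L M β μ K e₀ (k + 1) ω' (⟨(q.1 0).val, ZMod.val_lt (q.1 0)⟩, q.2) *
              klAnisoFamily L M β μ K e₀ k a' (⟨(q.1 0).val, ZMod.val_lt (q.1 0)⟩, q.2))‖ = 0 := fun zz => by
      rw [norm_eq_zero]
      exact Finset.sum_eq_zero fun q _ => by rw [hzero q, smul_zero]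
    simp_rw [hlhs, mul_zero, Finset.sum_const_zero]
    have hC₁A : 0 ≤ C₁A := by rw [hC₁A]; positivity
    have hC₁C : 0 ≤ C₁C := by rw [hC₁C]; positivity
    have hΛ1 : 0 < klScale e₀ (k + 1) := by rw [klScale]; positivity
    have hΛ0 : 0 < klScale e₀ k := by rw [klScale]; positivity
    have hB1 : 0 ≤ B₀xA := by rw [hB₀xA]; positivity
    have hB2 : 0 ≤ B₀xC := by rw [hB₀xC]; positivity
    positivity
  · exact charSumWt_thinPairDiff_le_twoScale B hA hA' hA3 hA3' hADt he hz hz1 hgap h3 hlo hhi hβ hρA k hK₂ hK₂' hMa hMb hNr hLz hT₁0 hT₂0 hd hd1 hd2 hd3 hd4 hB0 hB hν hνs hx hG₀ hG₁ hG₂ hG₃ hε₃₀ hε₃₁ hN₀ hN₁ hN₂ hN₃ hGΛ hA₃x hA₃x'   hκA hC₁A hB₀xA htA hε₂A hζA h𝔮₁A h𝔮₂A h𝔮₃₀A h𝔮₃₁A hd₁A hw₁A hd₂A hw₂A hd₃₀A hd₃₁A hw₃₀A hw₃₁A ho₁₀A ho₁₁A ho₂₀A ho₂₁A ho₂₂A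 ho₃₀A ho₃₁A ho₃₂A ho₃₃A hR₁₀A hR₁₁A hR₂₀A hR₂₁A hR₂₂A hR₃₀A hR₃₁A hR₃₂A hR₃₃A hr₁₀A hr₁₁A hr₂₀A hr₂₁A hr₂₂A hr₃₀A hr₃₁A hr₃₂A hr₃₃A hρfB htB hε₂B hζB h𝔮₁B h𝔮₂B h𝔮₃₀B h𝔮₃₁B hd₁B hw₁B hd₂B hw₂B hd₃₀B hd₃₁B hw₃₀B hw₃₁B ho₁₀B ho₁₁B ho₂₀B ho₂₁B ho₂₂B ho₃₀B ho₃₁B ho₃₂B ho₃₃B hR₁₀B hR₁₁B hR₂₀B hR₂₁B hR₂₂B hR₃₀B hR₃₁B hR₃₂B hR₃₃B hr₁₀B hr₁₁B hr₂₀B hr₂₁B hr₂₂B hr₃₀B hr₃₁B hr₃₂B hr₃₃B hκC hC₁C hB₀xC htC hε₂C hζC h𝔮₁C h𝔮₂C h𝔮₃₀C h𝔮₃₁C hd₁C hw₁C hd₂C hw₂C hd₃₀C hd₃₁C hw₃₀C hw₃₁C ho₁₀C ho₁₁C ho₂₀C ho₂₁C ho₂₂C ho₃₀C ho₃₁C ho₃₂C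 ho₃₃C hR₁₀C hR₁₁C hR₂₀C hR₂₁C hR₂₂C hR₃₀C hR₃₁C hR₃₂C hR₃₃C hr₁₀C hr₁₁C hr₂₀C hr₂₁C hr₂₂C hr₃₀C hr₃₁C hr₃₂C hr₃₃C hρfD htD hε₂D hζD h𝔮₁D h𝔮₂D h𝔮₃₀D h𝔮₃₁D hd₁D hw₁D hd₂D hw₂D hd₃₀D hd₃₁D hw₃₀D hw₃₁D ho₁₀D ho₁₁D ho₂₀D ho₂₁D ho₂₂D ho₃₀D ho₃₁D ho₃₂D ho₃₃D hR₁₀D hR₁₁D hR₂₀D hR₂₁D hR₂₂D hR₃₀D hR₃₁D hR₃₂D hR₃₃D hr₁₀D hr₁₁D hr₂₀D hr₂₁D hr₂₂D hr₃₀D hr₃₁D hr₃₂D hr₃₃D hqt₁E hqt₂E hqt₃E hDt₁E hDt₂E hθ₁E hθ₂E hθ₃E hqt₁F hqt₂F hqt₃F hDt₁F hDt₂F hθ₁F hθ₂F hθ₃F ω' a' _ (fun q => rfl) v hvj hvlen hvtan₁' hvtan₂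
      hs₀ hρ hρ₃ tθ₁ tθ₂ t₀ t₁ t₂ t₃ tv₀ tv₁ tv₂ tv₃ tw₀ tw₁ tw₂

end PieceStepFree

end Summit.HubbardSuperconductivity.HubbardSuperconductivity.Theorems.TorusFourierL2

end
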